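import Mathlib
import Summits.Ventures.PercRepro2.SwOutJunctionH1EdgeThm
import Summits.Ventures.PercRepro2.SwOutJunctionH1GTyped

/-!
# The (H1) junction with the edge `h–u` on the general doubly typed side, I: the transport
(blind cell PercRepro2, night-4 g33, 2026-08-28; proofs/NIGHT4-G33.md §6)

Towards g29's one-edge theorem (`rigidOK_of_junctionH1_edge`, SwOutJunctionH1EdgeThm) for g7's
general doubly typed row: the families LIFTED along `some` (`{S : Set (Option V) | some ⁻¹' S ∈ 𝓤} = {S ∣ some⁻¹' S ∈ 𝓤}`,
`X⁺ = some '' X`), the transport of the side and of the class along the uniform lift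
(`mem_gTypedQ_ulift_iff`, `mem_gOutSide_ulift_iff`), the rigid inequality on a block-closed part of
the side from a block decomposition (`card_le_of_blocks_on_g`), and «every block of a uniform side
point of a class of `G⁺` consists of uniform points» (`uniform_of_mem_blockOf_g`).
-/

namespace Summit.Ventures.PercRepro2

namespace LocRows

open Hull

variable {V : Type*} {E : Type*} [Fintype E] [DecidableEq E]

open scoped Classical

/-! ## The families lifted along `some` -/

section Families

variable {𝓤 : Set (Set V)}

omit [Fintype E] [DecidableEq E] in
/-- Membership in the family lifted along `some`: `{S ∣ some⁻¹' S ∈ 𝓤}`. -/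
lemma mem_liftSome_iff {S : Set (Option V)} :
    S ∈ {S : Set (Option V) | some ⁻¹' S ∈ 𝓤} ↔ some ⁻¹' S ∈ 𝓤 := Iff.rfl

omit [Fintype E] [DecidableEq E] in
/-- The lift of an up-set is an up-set. -/
lemma isUpperSet_liftSome (h𝓤 : IsUpperSet 𝓤) : IsUpperSet ({S : Set (Option V) | some ⁻¹' S ∈ 𝓤}) :=
  fun _ _ hSS' hS => h𝓤 (Set.preimage_mono hSS') hS

omit [Fintype E] [DecidableEq E] in
/-- The lift of a down-set is a down-set. -/
lemma isLowerSet_liftSome (h𝓤 : IsLowerSet 𝓤) : IsLowerSet ({S : Set (Option V) | some ⁻¹' S ∈ 𝓤}) :=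
  fun _ _ hSS' hS => h𝓤 (Set.preimage_mono hSS') hS

end Families

/-! ## The transport of the side -/

section Transport

variable {ends : E → Sym2 V} {e₀ : E} {h u l : V} {ζ : Config E} (he₀ : ends e₀ = s(h, u))
  {𝓤 𝓓 𝓓'' : Set (Set V)} {X : Set V} {𝓤' : Set (Set V)}
include he₀

omit [Fintype E] in
/-- The preimage under `some` of a red cluster of the uniform lift. -/
lemma preimage_cluster_ulift (x : V) :
    some ⁻¹' cluster (subdEnds ends e₀ h u l) (ulift e₀ ζ) (some x) = cluster ends ζ x := by
  ext v
  exact some_mem_cluster_ulift_iff he₀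

omit [Fintype E] in
/-- The preimage under `some` of a blue cluster of the uniform lift. -/
lemma preimage_cluster_blue_ulift (x : V) :
    some ⁻¹' cluster (subdEnds ends e₀ h u l) (blue (ulift e₀ ζ)) (some x) =
      cluster ends (blue ζ) x := by
  ext v
  exact some_mem_cluster_blue_ulift_iff he₀

/-- **The general doubly typed side transports** along the uniform lift, with the families lifted
along `some`. -/
theorem mem_gTypedQ_ulift_iff :
    ulift e₀ ζ ∈ gTypedQ (subdEnds ends e₀ h u l) (some l) (some h) ({S : Set (Option V) | some ⁻¹' S ∈ 𝓤}) ({S : Set (Option V) | some ⁻¹' S ∈ 𝓓})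
        ({S : Set (Option V) | some ⁻¹' S ∈ 𝓓''}) (some '' X) ({S : Set (Option V) | some ⁻¹' S ∈ 𝓤'}) ↔
      ζ ∈ gTypedQ ends l h 𝓤 𝓓 𝓓'' X 𝓤' := by
  rw [mem_gTypedQ, mem_gTypedQ]
  simp only [mem_liftSome_iff, preimage_cluster_ulift he₀, preimage_cluster_blue_ulift he₀,
    some_mem_hull_ulift_iff he₀, Set.forall_mem_image]

/-- **The general doubly typed class transports.** -/
theorem mem_gOutSide_ulift_iff {U : Set V} {ξ : Config E} (hh : h ∈ U) :
    ulift e₀ ζ ∈ gOutSide (subdEnds ends e₀ h u l) (some l) (some h) ({S : Set (Option V) | some ⁻¹' S ∈ 𝓤}) ({S : Set (Option V) | some ⁻¹' S ∈ 𝓓})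
        ({S : Set (Option V) | some ⁻¹' S ∈ 𝓓''}) (some '' X) ({S : Set (Option V) | some ⁻¹' S ∈ 𝓤'}) (subdRegion U) (ulift e₀ ξ) ↔
      ζ ∈ gOutSide ends l h 𝓤 𝓓 𝓓'' X 𝓤' U ξ := by
  rw [mem_gOutSide, mem_gOutSide, mem_gTypedQ_ulift_iff he₀, mem_outClass_ulift_iff he₀ hh]

end Transport

/-! ## The rigid inequality on a block-closed part, general doubly typed side -/

section BlocksOn

variable {ends : E → Sym2 V} {l h : V} {U : Set V} {ξ : Config E} {𝓤 𝓓 𝓓'' : Set (Set V)}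
  {X : Set V} {𝓤' : Set (Set V)}

/-- **The rigid inequality on a block-closed part `P` of the general doubly typed side from a block
decomposition.** -/
theorem card_le_of_blocks_on_g {K : Type*} (key : Config E → K) (block : K → Finset (Config E))
    (P : Config E → Prop)
    (hmem : ∀ ζ ∈ gOutSide ends l h 𝓤 𝓓 𝓓'' X 𝓤' U ξ, ζ ∈ block (key ζ))
    (hblock : ∀ ζ ∈ gOutSide ends l h 𝓤 𝓓 𝓓'' X 𝓤' U ξ, ∀ ζ' ∈ block (key ζ),
      ζ' ∈ gTypedQ ends l h 𝓤 𝓓 𝓓'' X 𝓤' →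
        ζ' ∈ gOutSide ends l h 𝓤 𝓓 𝓓'' X 𝓤' U ξ ∧ key ζ' = key ζ)
    (hP : ∀ ζ ∈ gOutSide ends l h 𝓤 𝓓 𝓓'' X 𝓤' U ξ, P ζ → ∀ ζ' ∈ block (key ζ), P ζ')
    (hineq : ∀ ζ ∈ gOutSide ends l h 𝓤 𝓓 𝓓'' X 𝓤' U ξ, ∀ 𝓔 : Set (Set E), IsUpperSet 𝓔 →
      ((block (key ζ)).filter fun ζ' =>
          ζ' ∈ gTypedQ ends l h 𝓤 𝓓 𝓓'' X 𝓤' ∧ redEdges ends ζ' h ∈ 𝓔).card ≤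
        ((block (key ζ)).filter fun ζ' =>
          ζ' ∈ gTypedQ ends l h 𝓤 𝓓 𝓓'' X 𝓤' ∧ blueEdges ends ζ' h ∈ 𝓔).card)
    {𝓔 : Set (Set E)} (h𝓔 : IsUpperSet 𝓔) :
    ((gOutSide ends l h 𝓤 𝓓 𝓓'' X 𝓤' U ξ).filter fun ζ => P ζ ∧ redEdges ends ζ h ∈ 𝓔).card ≤
      ((gOutSide ends l h 𝓤 𝓓 𝓓'' X 𝓤' U ξ).filter fun ζ => P ζ ∧ blueEdges ends ζ h ∈ 𝓔).card := by
  set C := gOutSide ends l h 𝓤 𝓓 𝓓'' X 𝓤' U ξ with hC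
  let S₀ : Finset K := (C.filter fun ζ => P ζ).image key
  have hmapR : ∀ ζ ∈ C.filter fun ζ => P ζ ∧ redEdges ends ζ h ∈ 𝓔, key ζ ∈ S₀ := by
    intro ζ hζ
    rw [Finset.mem_filter] at hζ
    exact Finset.mem_image_of_mem key (Finset.mem_filter.2 ⟨hζ.1, hζ.2.1⟩)
  have hmapB : ∀ ζ ∈ C.filter fun ζ => P ζ ∧ blueEdges ends ζ h ∈ 𝓔, key ζ ∈ S₀ := by
    intro ζ hζ
    rw [Finset.mem_filter] at hζ
    exact Finset.mem_image_of_mem key (Finset.mem_filter.2 ⟨hζ.1, hζ.2.1⟩)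
  rw [Finset.card_eq_sum_card_fiberwise hmapR, Finset.card_eq_sum_card_fiberwise hmapB]
  refine Finset.sum_le_sum fun k hk => ?_
  obtain ⟨ζ₀, hζ₀, rfl⟩ := Finset.mem_image.1 hk
  rw [Finset.mem_filter] at hζ₀
  -- the fibre of `key ζ₀` among the `P`-points is the side part of its block
  have hfib : ∀ Q : Config E → Prop,
      (C.filter fun ζ => P ζ ∧ Q ζ).filter (fun ζ => key ζ = key ζ₀) =
        (block (key ζ₀)).filter fun ζ' => ζ' ∈ gTypedQ ends l h 𝓤 𝓓 𝓓'' X 𝓤' ∧ Q ζ' := by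
    intro Q
    ext ζ'
    simp only [Finset.mem_filter]
    constructor
    · rintro ⟨⟨hζ', hPζ', hQ'⟩, hkey⟩
      have := hmem ζ' hζ'
      rw [hkey] at this
      exact ⟨this, (mem_gOutSide.1 hζ').1, hQ'⟩
    · rintro ⟨hb, hQ, hQ'⟩
      obtain ⟨hcl, hkey⟩ := hblock ζ₀ hζ₀.1 ζ' hb hQ
      exact ⟨⟨hcl, hP ζ₀ hζ₀.1 hζ₀.2 ζ' hb, hQ'⟩, hkey⟩
  rw [hfib, hfib]
  exact hineq ζ₀ hζ₀.1 𝓔 h𝓔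

end BlocksOn

/-! ## The uniform part of the class of `G⁺` -/

section Uniform

variable {ends : E → Sym2 V} {e₀ : E} {h u l : V} {U' : Set (Option V)} {ξ' : Config (E ⊕ Bool)}
  {𝓤 𝓓 𝓓'' : Set (Set (Option V))} {X : Set (Option V)} {𝓤' : Set (Set (Option V))}
  {F : Option V → Prop}

variable (hl : some l ∉ U') (hhu : h ≠ u)
  (hloop_h : ∀ e, subdEnds ends e₀ h u l e ≠ s(some h, some h))
  (hloop_u : ∀ e, subdEnds ends e₀ h u l e ≠ s(some u, some u))
  (hnadj : ∀ e, subdEnds ends e₀ h u l e ≠ s(some h, some u))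
  (hF : ∀ x, F x → ∀ S ∈ 𝓤, x ∈ S)
  (hout : ∀ x ∈ U', x ≠ some h → x ≠ some u →
    F x ∨ x ∈ X ∨ (∃ e y, subdEnds ends e₀ h u l e = s(x, y) ∧ y ∉ U') ∨
      (∀ e, x ∉ subdEnds ends e₀ h u l e))
  (hX : ∀ x ∈ X, x ∈ U' → ∀ e, x ∈ subdEnds ends e₀ h u l e → subdEnds ends e₀ h u l e = s(x, x))
  (hH1 : H1 (subdEnds ends e₀ h u l) U' (some h) (some u))
include hl hhu hloop_h hloop_u hnadj hF hout hX hH1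

/-- **Every block of a uniform side point of a class of `G⁺` consists of uniform points** (general
doubly typed side). -/
theorem uniform_of_mem_blockOf_g {ζ : Config (E ⊕ Bool)}
    (hζ : ζ ∈ gOutSide (subdEnds ends e₀ h u l) (some l) (some h) 𝓤 𝓓 𝓓'' X 𝓤' U' ξ')
    (hun : Uniform e₀ ζ) {ζ' : Config (E ⊕ Bool)}
    (hζ' : ζ' ∈ blockOf (subdEnds ends e₀ h u l) (some h) (some u)
      (keyOf (subdEnds ends e₀ h u l) U' ξ' (some h) (some u) ζ)) : Uniform e₀ ζ' := by
  have hhu' : (some h : Option V) ≠ some u := fun h' => hhu (Option.some_injective _ h')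
  have hu : some u ∈ hull (subdEnds ends e₀ h u l) ζ (some h) := some_u_mem_hull_of_uniform hun
  by_cases hk : hull (subdEnds ends e₀ h u l) ζ (some u) ⊆ U'
  · rw [keyOf_of_coreKind hu hk] at hζ'
    have hb := coreBase_of_coreKind_g hl hhu' hloop_h hloop_u hnadj hF hout hX hH1 hζ ⟨hu, hk⟩
    obtain ⟨ω, rfl⟩ := (mem_coreCube).1 hζ'
    exact uniform_coreReal hb ω
  by_cases hs : ShadowKind (subdEnds ends e₀ h u l) U' ξ' (some h) (some u) ζ
  · rw [keyOf_of_shadowKind hu hk hs] at hζ'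
    simp only [blockOf, shadowBlock] at hζ'
    obtain ⟨ω', rfl⟩ := (mem_shadowCube).1 hζ'
    exact uniform_shadowReal hs.1 ω'
  · rw [keyOf_of_plain hu hk hs] at hζ'
    have hc : CoreFree (subdEnds ends e₀ h u l) ζ (some h) := coreFree_of_escaping_g hF hout hζ hk
    simp only [blockOf, orbit, Finset.mem_image, Finset.mem_univ, true_and] at hζ'
    obtain ⟨ω, rfl⟩ := hζ'
    exact uniform_orbitReal hhu (uniform_allRed hhu hun hc) (coreFree_allRed hc) ω

end Uniform


end LocRows

end Summit.Ventures.PercRepro2
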